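import Summits.CriticalPhenomena.PercolationContinuityZ3.Theorems.PercNearOneGluingNoHeavyLowerTailForestRayleighTwoSum
import Summits.CriticalPhenomena.PercolationContinuityZ3.Theorems.PercNearOneGluingNoHeavyLowerTailForestRayleighKFour
import Summits.CriticalPhenomena.PercolationContinuityZ3.Theorems.PercNearOneGluingNoHeavyLowerTailForestRayleighClass
import HarnessLib

/-!
# Weighted forest negative correlation — a first member of the 2-sum class beyond `K₄` and tree-width 2: `K₄ ⊕₂ K₄`

Notation as in `…ForestRayleighTools`: `Z(D;K) = Σ_{G ⊆ D, ⟨G ∪ K⟩ acyclic} ∏ w`,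
`(R)(D;K;e,f) : Z(D;K∪{e,f})·Z(D;K) ≤ Z(D;K∪e)·Z(D;K∪f)`.

`forestsW_rayleigh_K4_twoSum_K4`: the graph on `Fin 6` consisting of two copies of `K₄` (on
`{0,1,2,3}` and on `{0,1,4,5}`) sharing the edge `01` — the 2-sum `K₄ ⊕₂ K₄` with the marker
kept; 6 vertices, 11 edges, tree-width 3, not a minor of `K₄` and not of tree-width ≤ 2 — has the
Rayleigh property: `(R)` holds for every instance inside it, all activities. Obtained by one
application of the 2-sum theorem `forestsW_rayleigh_twoSum` to two instances of
`forestsW_rayleigh_K4`; `forestsW_conn_posCorr_K4_twoSum_K4` is the resulting positive correlation of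
connection events in its arboreal gas. [Semple–Welsh 2008 Thm 4.4 with 2-sums (Cocks; Wagner 2008);
kernel] Theorems only; no definitions, no `sorry`.
-/

open Finset SimpleGraph
open scoped Classical

namespace Summit.CriticalPhenomena.PercolationContinuityZ3.Theorems.ForestRayleigh

set_option maxHeartbeats 400000 in
/-- **`K₄ ⊕₂ K₄` (marker kept) has the weighted forest Rayleigh property.** For the 11-edge graph
on `Fin 6` made of `K₄` on `{0,1,2,3}` and `K₄` on `{0,1,4,5}`: `(R)(D;K;e,f)` for every instance
inside it and all activities `w ≥ 0`. [2-sum theorem + `K₄`] -/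
theorem forestsW_rayleigh_K4_twoSum_K4 :
    ∀ (w : Sym2 (Fin 6) → ℝ), (∀ x, 0 ≤ w x) → ∀ (D K : Finset (Sym2 (Fin 6))) (e f : Sym2 (Fin 6)),
      D ∪ insert e (insert f K) ⊆ ({s(0, 1), s(0, 2), s(0, 3), s(1, 2), s(1, 3), s(2, 3), s(0, 4), s(0, 5), s(1, 4), s(1, 5), s(4, 5)} : Finset (Sym2 (Fin 6))) → Disjoint D K → e ∉ D → e ∉ K → f ∉ D →
      f ∉ K → e ≠ f →
      (∑ G ∈ D.powerset.filter (fun G =>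
        (fromEdgeSet ((G ∪ (insert e (insert f (K))) : Finset (Sym2 (Fin 6))) : Set (Sym2 (Fin 6)))).IsAcyclic), ∏ x ∈ G, w x) *
        (∑ G ∈ D.powerset.filter (fun G =>
        (fromEdgeSet ((G ∪ (K) : Finset (Sym2 (Fin 6))) : Set (Sym2 (Fin 6)))).IsAcyclic), ∏ x ∈ G, w x) ≤
      (∑ G ∈ D.powerset.filter (fun G =>
        (fromEdgeSet ((G ∪ (insert e (K)) : Finset (Sym2 (Fin 6))) : Set (Sym2 (Fin 6)))).IsAcyclic), ∏ x ∈ G, w x) *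
        (∑ G ∈ D.powerset.filter (fun G =>
        (fromEdgeSet ((G ∪ (insert f (K)) : Finset (Sym2 (Fin 6))) : Set (Sym2 (Fin 6)))).IsAcyclic), ∏ x ∈ G, w x) := by
  have h := forestsW_rayleigh_twoSum ({s(0, 2), s(0, 3), s(1, 2), s(1, 3), s(2, 3)} : Finset (Sym2 (Fin 6)))
    ({s(0, 4), s(0, 5), s(1, 4), s(1, 5), s(4, 5)} : Finset (Sym2 (Fin 6)))
    ((↑({0, 1, 2, 3} : Finset (Fin 6))) : Set (Fin 6)) ((↑({0, 1, 4, 5} : Finset (Fin 6))) : Set (Fin 6)) 0 1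
    (by decide) (by decide) (by decide) (by decide) (by decide) (by decide) (by decide) (by decide)
    (forestsW_rayleigh_K4 (0 : Fin 6) 1 2 3 (by decide) (by decide) (by decide) (by decide) (by decide)
      (by decide))
    (forestsW_rayleigh_K4 (0 : Fin 6) 1 4 5 (by decide) (by decide) (by decide) (by decide) (by decide)
      (by decide))
  rw [show insert s((0 : Fin 6), 1) (({s(0, 2), s(0, 3), s(1, 2), s(1, 3), s(2, 3)} : Finset (Sym2 (Fin 6))) ∪
      ({s(0, 4), s(0, 5), s(1, 4), s(1, 5), s(4, 5)} : Finset (Sym2 (Fin 6)))) = ({s(0, 1), s(0, 2), s(0, 3), s(1, 2), s(1, 3), s(2, 3), s(0, 4), s(0, 5), s(1, 4), s(1, 5), s(4, 5)} : Finset (Sym2 (Fin 6))) from by decide] at h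
  exact h

/-- **Positive correlation of connection events in the arboreal gas of `K₄ ⊕₂ K₄`** (and of every
minor of it), all activities, for pairs of vertices that are equal or adjacent in it.
[Theorem A of memo KCLUSTER-gen86 on this graph] -/
theorem forestsW_conn_posCorr_K4_twoSum_K4 (w : Sym2 (Fin 6) → ℝ) (hw : ∀ x, 0 ≤ w x)
    (D K : Finset (Sym2 (Fin 6))) (hDK : Disjoint D K)
    (hsub : D ∪ K ⊆ ({s(0, 1), s(0, 2), s(0, 3), s(1, 2), s(1, 3), s(2, 3), s(0, 4), s(0, 5), s(1, 4), s(1, 5), s(4, 5)} : Finset (Sym2 (Fin 6)))) {a b c d : Fin 6}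
    (hab : a = b ∨ s(a, b) ∈ ({s(0, 1), s(0, 2), s(0, 3), s(1, 2), s(1, 3), s(2, 3), s(0, 4), s(0, 5), s(1, 4), s(1, 5), s(4, 5)} : Finset (Sym2 (Fin 6))))
    (hcd : c = d ∨ s(c, d) ∈ ({s(0, 1), s(0, 2), s(0, 3), s(1, 2), s(1, 3), s(2, 3), s(0, 4), s(0, 5), s(1, 4), s(1, 5), s(4, 5)} : Finset (Sym2 (Fin 6)))) :
    (∑ G ∈ D.powerset.filter (fun G =>
        (fromEdgeSet ((G ∪ K : Finset (Sym2 (Fin 6))) : Set (Sym2 (Fin 6)))).IsAcyclic ∧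
        (fromEdgeSet ((G ∪ K : Finset (Sym2 (Fin 6))) : Set (Sym2 (Fin 6)))).Reachable a b), ∏ x ∈ G, w x) *
      (∑ G ∈ D.powerset.filter (fun G =>
        (fromEdgeSet ((G ∪ K : Finset (Sym2 (Fin 6))) : Set (Sym2 (Fin 6)))).IsAcyclic ∧
        (fromEdgeSet ((G ∪ K : Finset (Sym2 (Fin 6))) : Set (Sym2 (Fin 6)))).Reachable c d), ∏ x ∈ G, w x) ≤
    (∑ G ∈ D.powerset.filter (fun G =>
        (fromEdgeSet ((G ∪ K : Finset (Sym2 (Fin 6))) : Set (Sym2 (Fin 6)))).IsAcyclic), ∏ x ∈ G, w x) *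
      (∑ G ∈ D.powerset.filter (fun G =>
        (fromEdgeSet ((G ∪ K : Finset (Sym2 (Fin 6))) : Set (Sym2 (Fin 6)))).IsAcyclic ∧
        ((fromEdgeSet ((G ∪ K : Finset (Sym2 (Fin 6))) : Set (Sym2 (Fin 6)))).Reachable a b ∧
         (fromEdgeSet ((G ∪ K : Finset (Sym2 (Fin 6))) : Set (Sym2 (Fin 6)))).Reachable c d)), ∏ x ∈ G, w x) :=
  forestsW_conn_posCorr_of_rayleigh _ (by decide) forestsW_rayleigh_K4_twoSum_K4 w hw D K hDK hsub
    hab hcd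

end Summit.CriticalPhenomena.PercolationContinuityZ3.Theorems.ForestRayleigh
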